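import Mathlib

/-!
# `IsotropyFromPowerCounting.CurvatureSandwichBound` — iterated Schwarz (pure Hilbert space)

Stub `stub_iterSchwarz` of line `Sketch` for crux `CurvatureSandwichBound` of route
`IsotropyFromPowerCounting` (stmt-QuantumFields-18372).

This is the abstract Hilbert-space core of the classical iterated Schwarz / multiple-reflection
argument (Glimm–Jaffe, *Quantum Physics*, Thm 10.5.5): if `‖y‖² ≤ ‖x‖ ‖p 1‖`,
`‖p k‖² ≤ ‖x‖ ‖p (2k)‖` and the chain grows at most geometrically, `‖p k‖ ≤ C Λ^(2k)`, then
`‖y‖ ≤ Λ ‖x‖`.  In the line, `x = Ψ_W`, `y = Ψ_{XW}` and `p k = Ψ_{(X♯X)^k W}`; the hypotheses are the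
two Schwarz steps and the chain-growth bound, and the `2^m`-th root eats the constant `C`.

Proof: by induction on `m`, `‖x‖ ‖y‖^(2^(m+1)) ≤ ‖x‖^(2^(m+1)) ‖p (2^m)‖` (square and use the second
Schwarz step at `k = 2^m`); with the growth bound, `‖x‖ ‖y‖^M ≤ C (Λ ‖x‖)^M` for `M = 2^(m+1)`; if
`Λ ‖x‖ < ‖y‖` the ratio `r = ‖y‖ / (Λ ‖x‖) > 1` would have bounded powers `r^M ≤ C / ‖x‖`,
contradicting `r^n → ∞`.  The degenerate cases `‖x‖ = 0` and `Λ ‖x‖ = 0` are immediate.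

The file is Mathlib-only and adds no Yang–Mills content.
-/

namespace Summit.QuantumFields.YangMills.Theorems.CurvatureSandwichBound.Sketch

/-- Real-variable induction behind the iterated Schwarz bound: from `b² ≤ a · q 1` and
`(q k)² ≤ a · q (2k)` (`0 < a`, `0 ≤ b`) one gets `a · b^(2^(m+1)) ≤ a^(2^(m+1)) · q (2^m)` for
every `m`. -/
theorem iterSchwarz_real_aux {a b : ℝ} {q : ℕ → ℝ} (ha : 0 < a) (hb : 0 ≤ b)
    (h1 : b ^ 2 ≤ a * q 1) (h2 : ∀ k : ℕ, q k ^ 2 ≤ a * q (2 * k)) (m : ℕ) :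
    a * b ^ (2 ^ (m + 1)) ≤ a ^ (2 ^ (m + 1)) * q (2 ^ m) := by
  induction m with
  | zero =>
    have h : a * b ^ 2 ≤ a * (a * q 1) := mul_le_mul_of_nonneg_left h1 ha.le
    calc a * b ^ (2 ^ (0 + 1)) = a * b ^ 2 := by norm_num
      _ ≤ a * (a * q 1) := h
      _ = a ^ (2 ^ (0 + 1)) * q (2 ^ 0) := by ring
  | succ m ih =>
    have hlhs : 0 ≤ a * b ^ (2 ^ (m + 1)) := by positivity
    have hsq : (a * b ^ (2 ^ (m + 1))) ^ 2 ≤ (a ^ (2 ^ (m + 1)) * q (2 ^ m)) ^ 2 :=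
      pow_le_pow_left₀ hlhs ih 2
    have hpow : 0 ≤ a ^ (2 ^ (m + 2)) := pow_nonneg ha.le _
    have key : a * (a * b ^ (2 ^ (m + 2))) ≤ a * (a ^ (2 ^ (m + 2)) * q (2 ^ (m + 1))) :=
      calc a * (a * b ^ (2 ^ (m + 2))) = (a * b ^ (2 ^ (m + 1))) ^ 2 := by ring
        _ ≤ (a ^ (2 ^ (m + 1)) * q (2 ^ m)) ^ 2 := hsq
        _ = a ^ (2 ^ (m + 2)) * q (2 ^ m) ^ 2 := by ring
        _ ≤ a ^ (2 ^ (m + 2)) * (a * q (2 * 2 ^ m)) := mul_le_mul_of_nonneg_left (h2 _) hpow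
        _ = a * (a ^ (2 ^ (m + 2)) * q (2 ^ (m + 1))) := by rw [← pow_succ']; ring
    exact le_of_mul_le_mul_left key ha

/-- **Iterated Schwarz / multiple-reflection bound (pure Hilbert space).**
If `‖y‖² ≤ ‖x‖‖p₁‖`, `‖p_k‖² ≤ ‖x‖‖p_{2k}‖` and `‖p_k‖ ≤ C Λ^{2k}` for all `k`, then `‖y‖ ≤ Λ‖x‖`
(by induction `‖x‖ ‖y‖^(2^(m+1)) ≤ ‖x‖^(2^(m+1)) ‖p_(2^m)‖ ≤ ‖x‖^(2^(m+1)) C Λ^(2^(m+1))`, then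
`m → ∞`).  In the line `x = Ψ_W`, `y = Ψ_{XW}`, `p_k = Ψ_{P^k W}` (Glimm–Jaffe Thm 10.5.5). -/
theorem stub_iterSchwarz {H : Type*} [NormedAddCommGroup H] [InnerProductSpace ℂ H]
    (x y : H) (p : ℕ → H) (C Λ : ℝ) (hC : 0 ≤ C) (hΛ : 0 ≤ Λ)
    (h1 : ‖y‖ ^ 2 ≤ ‖x‖ * ‖p 1‖) (h2 : ∀ k : ℕ, ‖p k‖ ^ 2 ≤ ‖x‖ * ‖p (2 * k)‖)
    (h3 : ∀ k : ℕ, ‖p k‖ ≤ C * Λ ^ (2 * k)) : ‖y‖ ≤ Λ * ‖x‖ := by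
  have _hC0 : 0 ≤ C := hC
  rcases (norm_nonneg x).eq_or_lt with hx0 | hx0
  · -- Degenerate case `‖x‖ = 0`: the first Schwarz step forces `‖y‖ = 0`.
    have hy2 : ‖y‖ ^ 2 ≤ 0 := by
      calc ‖y‖ ^ 2 ≤ ‖x‖ * ‖p 1‖ := h1
        _ = 0 := by rw [← hx0, zero_mul]
    have hy0 : ‖y‖ = 0 := (pow_eq_zero_iff two_ne_zero).mp (le_antisymm hy2 (sq_nonneg _))
    rw [hy0]
    exact mul_nonneg hΛ (norm_nonneg x)
  · -- Main case `0 < ‖x‖`.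
    have chain : ∀ m : ℕ, ‖x‖ * ‖y‖ ^ (2 ^ (m + 1)) ≤ C * (Λ * ‖x‖) ^ (2 ^ (m + 1)) := by
      intro m
      have hpow : 0 ≤ ‖x‖ ^ (2 ^ (m + 1)) := pow_nonneg (norm_nonneg x) _
      calc ‖x‖ * ‖y‖ ^ (2 ^ (m + 1)) ≤ ‖x‖ ^ (2 ^ (m + 1)) * ‖p (2 ^ m)‖ :=
            iterSchwarz_real_aux hx0 (norm_nonneg y) h1 h2 m
        _ ≤ ‖x‖ ^ (2 ^ (m + 1)) * (C * Λ ^ (2 * 2 ^ m)) := mul_le_mul_of_nonneg_left (h3 _) hpow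
        _ = C * (Λ * ‖x‖) ^ (2 ^ (m + 1)) := by rw [← pow_succ']; ring
    rcases le_or_gt ‖y‖ (Λ * ‖x‖) with hle | hlt
    · exact hle
    exfalso
    have hypos : 0 < ‖y‖ := lt_of_le_of_lt (mul_nonneg hΛ (norm_nonneg x)) hlt
    rcases (mul_nonneg hΛ (norm_nonneg x)).eq_or_lt with hc0 | hc0
    · -- `Λ * ‖x‖ = 0`: the chain bound at `m = 0` forces `‖x‖ * ‖y‖² ≤ 0`.
      have h0 := chain 0
      have hpos : 0 < ‖x‖ * ‖y‖ ^ (2 ^ (0 + 1)) := mul_pos hx0 (pow_pos hypos _)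
      rw [← hc0, zero_pow (pow_ne_zero _ two_ne_zero), mul_zero] at h0
      exact absurd h0 (not_le.mpr hpos)
    · -- `0 < Λ * ‖x‖`: the ratio `r = ‖y‖ / (Λ ‖x‖) > 1` has bounded powers, absurd.
      set c : ℝ := Λ * ‖x‖
      have hr : 1 < ‖y‖ / c := (one_lt_div hc0).mpr hlt
      obtain ⟨n, hn⟩ := pow_unbounded_of_one_lt (C / ‖x‖) hr
      have hle : n ≤ 2 ^ (n + 1) :=
        Nat.lt_two_pow_self.le.trans (Nat.pow_le_pow_right two_pos (Nat.le_succ n))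
      have hmono : (‖y‖ / c) ^ n ≤ (‖y‖ / c) ^ (2 ^ (n + 1)) := pow_le_pow_right₀ hr.le hle
      have hbd : (‖y‖ / c) ^ (2 ^ (n + 1)) ≤ C / ‖x‖ := by
        rw [div_pow, div_le_div_iff₀ (pow_pos hc0 _) hx0]
        have h := chain n
        linarith [h]
      linarith [hn, hmono, hbd]

end Summit.QuantumFields.YangMills.Theorems.CurvatureSandwichBound.Sketch
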